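import Mathlib
import HarnessLib
import Literature.Probability.MarkovChains.PathCoupling

/-!
# Coarse Ricci curvature of a Markov chain, `κ(x,y) = 1 − W₁(m_x,m_y)/d(x,y)`: contraction, unique invariant law, bias of Lipschitz observables, `L¹` Bonnet–Myers (Ollivier 2009, §1–§2.3)

HONEST FRAMING: exact (Metropolis-corrected) sampling algorithms for lattice gauge theory; figures
of merit are autocorrelation/cost numbers at stated couplings and volumes; no continuum-physics claim.

The FINITE-STATE case of Y. Ollivier, *Ricci curvature of Markov chains on metric spaces*, J. Funct.
Anal. 256 (2009) 810–864 [Ollivier2009] (read on arXiv:math/0701886), §1 Definitions 2–4 and §2.1–2.3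
(Propositions 2–5, Corollaries 1–2), in the vocabulary of `PathCoupling.lean`: the `L¹` transportation
distance `W₁ = ρ_K` is `transportDist ρ` ((14.2)–(14.3) of Levin–Peres–Wilmer), a "random walk"
`m = (m_x)` is a row-stochastic kernel `P` (`m_x = P(x,·)`), `μ ∗ m = μP = stepLaw P μ`,
`m_x^{∗n} = δ_x Pⁿ = lawAt P δ_x n`.  Everything is PROVED (finite sums; 0 named facts); the
measurability / first-moment provisos of the paper are vacuous on a finite space.

* **DEFINITION 3** `coarseRicci ρ P x y = κ(x,y) := 1 − W₁(m_x,m_y)/ρ(x,y)` and **DEFINITION 4 (jump)**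
  `jump ρ P x = J(x) := W₁(δ_x, m_x)`, with `transportDist_single_left` (`W₁(δ_x,μ) = Σ_y ρ(x,y)μ(y)`,
  so `J(x) = E_{m_x} ρ(x,·)`: `jump_eq_sum`) [cite: Ollivier2009, §1 Definition 3; §1.2 Definition 4];
* `abs_lawMean_sub_le_transportDist` — for an `L`-Lipschitz `f`, **`|E_μ f − E_μ' f| ≤ L·W₁(μ,μ')`**
  (the easy half of Kantorovich duality, used throughout) [cite: Ollivier2009, §2.2 proof of Cor. 2
  ("if `f` is a 1-Lipschitz function, for any two distributions `μ, μ'` one has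
  `|E_μ f − E_{μ'} f| ≤ W₁(μ,μ')`")]; `mul_tvDist_le_transportDist` (`δ·‖μ − ν‖_TV ≤ W₁(μ,ν)` when
  `ρ ≥ δ` off the diagonal) [cite: LevinPeres2017, §14.2 eqs. (14.6)–(14.7) (scaled)];
* **PROPOSITION 2** `Ollivier2009_prop_2` — in an `ε`-geodesic space, `κ(x,y) ≥ κ` for pairs with
  `ρ(x,y) ≤ ε` implies `κ(x,y) ≥ κ` for all pairs ("since `W₁` is a distance") [cite: Ollivier2009,
  §2.1 Prop. 2];
* **PROPOSITION 3** `Ollivier2009_prop_3` / `Ollivier2009_prop_3_converse` — **`κ(x,y) ≥ κ` for all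
  `x ≠ y` iff `W₁(μ∗m, μ'∗m) ≤ (1 − κ)W₁(μ,μ')` for all laws `μ, μ'`** [cite: Ollivier2009, §2.2
  Prop. 3];
* **COROLLARY 1** `Ollivier2009_cor_1_unique` (for `κ > 0` the invariant law is unique),
  `Ollivier2009_cor_1_convergence` (**`W₁(μ∗m^{∗n}, ν) ≤ (1 − κ)ⁿ W₁(μ,ν)`**),
  `transportDist_single_invariant_le` (`W₁(δ_x,ν) ≤ J(x)/κ`) and `Ollivier2009_cor_1_pointwise`
  (**`W₁(m_x^{∗n}, ν) ≤ (1 − κ)ⁿ J(x)/κ`**) [cite: Ollivier2009, §2.2 Cor. 1];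
* **COROLLARY 2** `Ollivier2009_cor_2` (for 1-Lipschitz `f`: **`|E_ν f − E_μ f| ≤ W₁(μ, μ∗m)/κ`**)
  and `Ollivier2009_cor_2_pointwise` (**`|f(x) − E_ν f| ≤ J(x)/κ`**) [cite: Ollivier2009, §2.2 Cor. 2];
* **PROPOSITION 4 (`L¹` Bonnet–Myers)** `Ollivier2009_prop_4` — `κ(x,y)·ρ(x,y) ≤ J(x) + J(y)`
  [cite: Ollivier2009, §2.3 Prop. 4]; **PROPOSITION 5 (average `L¹` Bonnet–Myers)**
  `Ollivier2009_prop_5` (`∫ρ(x,y)dν(y) ≤ J(x)/κ`) and `Ollivier2009_prop_5_pair`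
  (`∫∫ρ(y,z)dν(y)dν(z) ≤ 2J(x₀)/κ` for every `x₀`) [cite: Ollivier2009, §2.3 Prop. 5].

Context (cell pub-lqcd, venture LatticeQCDFlow): positive coarse Ricci curvature is the all-pairs
contraction (14.1) of `PathCoupling.lean` (`1 − κ = e^{−α}`); Corollaries 1–2 are the burn-in /
bias estimates for Lipschitz observables of a contracting MCMC kernel (the inputs of Joulin–Ollivier's
MCMC error bounds), stated here at kernel level.

Also §2.4 PROPOSITION 6 (Superposition): `isCoupling_mixture`, `transportDist_mixture_le`
(`W₁(Σα_iμ_i, Σα_iν_i) ≤ Σα_iW₁(μ_i,ν_i)`), `Ollivier2009_prop_6` (curvature of `Σ α_i m^{(i)}` is at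
least `Σ α_i κ_i`) [cite: Ollivier2009, §2.4 Prop. 6].  and §2.4 PROPOSITION 7 (`L¹` tensorization) for TWO factors: `sumDist`, `liftFst`, `liftSnd`,
`tensorWalk`, `transportDist_liftFst_le`, `transportDist_liftSnd_le`, `Ollivier2009_prop_7` (curvature of
`α m¹⊗δ + (1−α) δ⊗m²` on `(X₁×X₂, d₁+d₂)` is at least `min(ακ₁,(1−α)κ₂)`) [cite: Ollivier2009, §2.4 Prop. 7].
-/

namespace Literature.Probability.MarkovChains

open Finset

variable {X : Type*} [Fintype X] [DecidableEq X]

/-! ## Definitions 3–4 -/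

/-- **DEFINITION 3**: the coarse Ricci curvature of `(X, ρ, P)` in the direction `(x,y)`,
`κ(x,y) := 1 − W₁(P(x,·), P(y,·))/ρ(x,y)`. [cite: Ollivier2009, §1 Definition 3] -/
noncomputable def coarseRicci (ρ : X → X → ℝ) (P : X → X → ℝ) (x y : X) : ℝ :=
  1 - transportDist ρ (P x) (P y) / ρ x y

/-- **DEFINITION 4 (jump)**: `J(x) := W₁(δ_x, P(x,·))` (`= E_{P(x,·)} ρ(x,·)`, `jump_eq_sum`).
[cite: Ollivier2009, §1.2 Definition 4 (jump)] -/
noncomputable def jump (ρ : X → X → ℝ) (P : X → X → ℝ) (x : X) : ℝ :=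
  transportDist ρ (Pi.single x 1) (P x)

omit [DecidableEq X] in
/-- `κ(x,y) ≥ κ` means `W₁(P(x,·),P(y,·)) ≤ (1 − κ)ρ(x,y)` (for `ρ(x,y) > 0`).
[cite: Ollivier2009, §1 Definition 3] -/
theorem le_coarseRicci_iff {ρ : X → X → ℝ} {P : X → X → ℝ} {x y : X} (hxy : 0 < ρ x y) (κ : ℝ) :
    κ ≤ coarseRicci ρ P x y ↔ transportDist ρ (P x) (P y) ≤ (1 - κ) * ρ x y := by
  unfold coarseRicci
  rw [le_sub_comm, div_le_iff₀ hxy]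

/-- The only coupling of `δ_x` with a law `μ` of the same mass is `q(a,b) = 1{a = x}μ(b)`; hence
**`W₁(δ_x, μ) = Σ_y ρ(x,y)μ(y)`** for a probability vector `μ`. [cite: Ollivier2009, §2.2 proof of
Cor. 1 ("noting that `J(x) = W₁(δ_x, m_x)`")] -/
theorem transportDist_single_left (ρ : X → X → ℝ) (x : X) {μ : X → ℝ} (hμ : ∀ b, 0 ≤ μ b)
    (hμ1 : ∑ b, μ b = 1) : transportDist ρ (Pi.single x 1) μ = ∑ y, ρ x y * μ y := by
  have key : ∀ q, IsCoupling (Pi.single x 1 : X → ℝ) μ q → transportCost ρ q = ∑ y, ρ x y * μ y := by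
    intro q hq
    have hax : ∀ a, a ≠ x → ∀ b, q a b = 0 := fun a ha b =>
      hq.apply_eq_zero_of_left (Pi.single_eq_of_ne ha _) b
    have hxb : ∀ b, q x b = μ b := fun b => by
      have h := hq.2.2 b
      rw [sum_eq_single x (fun a _ ha => hax a ha b) (fun h => (h (mem_univ x)).elim)] at h
      exact h
    unfold transportCost
    rw [sum_eq_single x (fun a _ ha => sum_eq_zero fun b _ => by rw [hax a ha b, mul_zero])
      (fun h => (h (mem_univ x)).elim)]
    exact sum_congr rfl fun b _ => by rw [hxb b]
  have hq0 : IsCoupling (Pi.single x 1 : X → ℝ) μ (fun a b => (Pi.single x 1 : X → ℝ) a * μ b) :=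
    isCoupling_mul (fun a => by rw [Pi.single_apply]; split_ifs <;> norm_num) hμ
      (by rw [sum_eq_single x (fun a _ ha => Pi.single_eq_of_ne ha _) (fun h => (h (mem_univ x)).elim),
        Pi.single_eq_same]) hμ1
  have hs : transportCost ρ '' couplings (Pi.single x 1 : X → ℝ) μ = {∑ y, ρ x y * μ y} := by
    refine Set.eq_singleton_iff_unique_mem.2 ⟨⟨_, hq0, key _ hq0⟩, ?_⟩
    rintro _ ⟨q, hq, rfl⟩
    exact key q hq
  unfold transportDist
  rw [hs, csInf_singleton]

/-- **`J(x) = E_{m_x} ρ(x,·) = Σ_y ρ(x,y)P(x,y)`** for a row-stochastic `P`. [cite: Ollivier2009,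
§1.2 Definition 4] -/
theorem jump_eq_sum (ρ : X → X → ℝ) {P : X → X → ℝ} (hP : IsRowStochastic P) (x : X) :
    jump ρ P x = ∑ y, ρ x y * P x y :=
  transportDist_single_left ρ x (hP.1 x) (hP.2 x)

omit [DecidableEq X] in
/-- `J(x) ≥ 0` for `ρ ≥ 0`. [cite: Ollivier2009, §1.2 Definition 4] -/
theorem jump_nonneg [DecidableEq X] {ρ : X → X → ℝ} (hρ : ∀ a b, 0 ≤ ρ a b) (P : X → X → ℝ) (x : X) :
    0 ≤ jump ρ P x :=
  transportDist_nonneg hρ _ _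

/-! ## Lipschitz observables and total variation against `W₁` -/

omit [DecidableEq X] in
/-- Under a coupling `q` of `μ, μ'`: `E_μ f − E_{μ'} f = Σ_{a,b} q(a,b)(f(a) − f(b))`.
[cite: Ollivier2009, §2.2 proof of Cor. 2] -/
theorem sum_mul_sub_sum_mul_of_coupling {μ μ' : X → ℝ} {q : X → X → ℝ} (hq : IsCoupling μ μ' q)
    (f : X → ℝ) : ∑ a, μ a * f a - ∑ b, μ' b * f b = ∑ a, ∑ b, q a b * (f a - f b) := by
  simp_rw [mul_sub, sum_sub_distrib]
  congr 1
  · refine sum_congr rfl fun a _ => ?_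
    rw [← sum_mul, hq.2.1 a]
  · rw [sum_comm]
    refine sum_congr rfl fun b _ => ?_
    rw [← sum_mul, hq.2.2 b]

omit [DecidableEq X] in
/-- **"If `f` is 1-Lipschitz, `|E_μ f − E_{μ'} f| ≤ W₁(μ,μ')`"** — here for an `L`-Lipschitz `f`
(`|f(a) − f(b)| ≤ Lρ(a,b)`) and laws admitting a coupling: `|E_μ f − E_{μ'} f| ≤ L·W₁(μ,μ')`.
[cite: Ollivier2009, §2.2 proof of Cor. 2] -/
theorem abs_lawMean_sub_le_transportDist {ρ : X → X → ℝ} {f : X → ℝ} {L : ℝ}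
    (hf : ∀ a b, |f a - f b| ≤ L * ρ a b) {μ μ' : X → ℝ} (hne : (couplings μ μ').Nonempty) :
    |∑ a, μ a * f a - ∑ b, μ' b * f b| ≤ L * transportDist ρ μ μ' := by
  obtain ⟨q, hq, hqe, -⟩ := LevinPeres2017_rem_14_2 ρ hne
  rw [sum_mul_sub_sum_mul_of_coupling hq, ← hqe]
  unfold transportCost
  rw [mul_sum]
  refine (abs_sum_le_sum_abs _ _).trans (sum_le_sum fun a _ => ?_)
  rw [mul_sum]
  refine (abs_sum_le_sum_abs _ _).trans (sum_le_sum fun b _ => ?_)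
  rw [abs_mul, abs_of_nonneg (hq.1 a b)]
  calc q a b * |f a - f b| ≤ q a b * (L * ρ a b) := mul_le_mul_of_nonneg_left (hf a b) (hq.1 a b)
    _ = L * (ρ a b * q a b) := by ring

/-- **`δ·‖μ − ν‖_TV ≤ W₁(μ,ν)`** when `ρ ≥ 0` and `ρ(a,b) ≥ δ ≥ 0` for `a ≠ b` (probability vectors):
(14.6)–(14.7) for the rescaled distance. [cite: LevinPeres2017, §14.2 eqs. (14.6)–(14.7)] -/
theorem mul_tvDist_le_transportDist {ρ : X → X → ℝ} (hρ : ∀ a b, 0 ≤ ρ a b) {δ : ℝ} (hδ : 0 ≤ δ)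
    (hρδ : ∀ a b, a ≠ b → δ ≤ ρ a b) {μ ν : X → ℝ} (hμ : ∀ a, 0 ≤ μ a) (hν : ∀ b, 0 ≤ ν b)
    (hμ1 : ∑ a, μ a = 1) (hν1 : ∑ b, ν b = 1) : δ * tvDist μ ν ≤ transportDist ρ μ ν := by
  refine le_transportDist (couplings_nonempty hμ hν hμ1 hν1) fun q hq => ?_
  calc δ * tvDist μ ν ≤ δ * ∑ a, ∑ b ∈ univ.erase a, q a b :=
        mul_le_mul_of_nonneg_left (LevinPeres2017_prop_4_7_le hq) hδ
    _ = ∑ a, ∑ b ∈ univ.erase a, δ * q a b := by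
        rw [mul_sum]; exact sum_congr rfl fun a _ => mul_sum _ _ _
    _ ≤ ∑ a, ∑ b ∈ univ.erase a, ρ a b * q a b :=
        sum_le_sum fun a _ => sum_le_sum fun b hb =>
          mul_le_mul_of_nonneg_right (hρδ a b (ne_of_mem_erase hb).symm) (hq.1 a b)
    _ ≤ transportCost ρ q := by
        unfold transportCost
        exact sum_le_sum fun a _ => sum_le_sum_of_subset_of_nonneg (erase_subset _ _)
          fun b _ _ => mul_nonneg (hρ a b) (hq.1 a b)

/-! ## Proposition 3: `κ ≥ κ₀` everywhere ⇔ `W₁`-contraction by `1 − κ₀` -/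

section Contraction

variable {ρ : X → X → ℝ} {P : X → X → ℝ}

/-- `m_x = δ_x ∗ m`: `(δ_x P)(y) = P(x,y)`, pointwise. [cite: Ollivier2009, §2.2 proof of Prop. 3 ("by
definition `δ_x ∗ m = m_x`")] -/
theorem stepLaw_single_apply (P : X → X → ℝ) (x y : X) : stepLaw P (Pi.single x 1) y = P x y := by
  unfold stepLaw
  rw [sum_eq_single x (fun a _ ha => by rw [Pi.single_eq_of_ne ha, zero_mul])
    (fun h => (h (mem_univ x)).elim), Pi.single_eq_same, one_mul]

/-- `m_x = δ_x ∗ m` as an equality of laws (the tree's `StochasticDomination.lean` keeps a private copy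
of this one-liner; restated here pointwise-derived to stay import-light). [cite: Ollivier2009, §2.2
proof of Prop. 3] -/
theorem stepLaw_single_eq_row (P : X → X → ℝ) (x : X) : stepLaw P (Pi.single x 1) = fun y => P x y :=
  funext (stepLaw_single_apply P x)

/-- **PROPOSITION 3 (⇒).** If `κ(x,y) ≥ κ` for all `x ≠ y` (metric `ρ`: `ρ ≥ 0`, `ρ(x,x) = 0`,
`ρ(x,y) > 0` for `x ≠ y`; `P` row-stochastic), then for any two probability vectors
**`W₁(μ∗m, μ'∗m) ≤ (1 − κ)W₁(μ,μ')`**. [cite: Ollivier2009, §2.2 Prop. 3 (the converse direction of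
its proof: "`∫dΞ(x,y) ξ_{xy}` is a coupling between `μ∗m` and `μ'∗m`")] -/
theorem Ollivier2009_prop_3 (hP : IsRowStochastic P) (hρ : ∀ a b, 0 ≤ ρ a b) (hρ0 : ∀ a, ρ a a = 0)
    (hρpos : ∀ a b, a ≠ b → 0 < ρ a b) {κ : ℝ} (hκ : ∀ x y, x ≠ y → κ ≤ coarseRicci ρ P x y)
    {μ μ' : X → ℝ} (hμ : ∀ a, 0 ≤ μ a) (hμ' : ∀ b, 0 ≤ μ' b) (hμ1 : ∑ a, μ a = 1)
    (hμ'1 : ∑ b, μ' b = 1) :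
    transportDist ρ (stepLaw P μ) (stepLaw P μ') ≤ (1 - κ) * transportDist ρ μ μ' := by
  refine transportDist_stepLaw_le_of_forall (fun x y => ?_) (couplings_nonempty hμ hμ' hμ1 hμ'1)
  -- a coupling `ξ_{xy}` of `m_x, m_y` witnessing `κ(x,y) ≥ κ` (an optimal one)
  obtain ⟨θ, hθ, hθe⟩ := exists_optimalCoupling ρ (hP.1 x) (hP.1 y) (hP.2 x) (hP.2 y)
  refine ⟨θ, hθ, ?_⟩
  rw [hθe]
  by_cases hxy : x = y
  · subst hxy
    rw [transportDist_self hρ hρ0 (hP.1 x), hρ0, mul_zero]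
  · exact (le_coarseRicci_iff (hρpos x y hxy) κ).1 (hκ x y hxy)

omit [DecidableEq X] in
/-- **PROPOSITION 3 (⇐).** If `W₁(μ∗m,μ'∗m) ≤ (1 − κ)W₁(μ,μ')` for all probability vectors, then
`κ(x,y) ≥ κ` for all `x ≠ y` ("let `μ = δ_x` and `μ' = δ_y`"). [cite: Ollivier2009, §2.2 Prop. 3
(first half of the proof)] -/
theorem Ollivier2009_prop_3_converse [DecidableEq X] (hρpos : ∀ a b, a ≠ b → 0 < ρ a b) {κ : ℝ}
    (hcontr : ∀ μ μ' : X → ℝ, (∀ a, 0 ≤ μ a) → (∀ b, 0 ≤ μ' b) → ∑ a, μ a = 1 → ∑ b, μ' b = 1 →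
      transportDist ρ (stepLaw P μ) (stepLaw P μ') ≤ (1 - κ) * transportDist ρ μ μ')
    {x y : X} (hxy : x ≠ y) : κ ≤ coarseRicci ρ P x y := by
  rw [le_coarseRicci_iff (hρpos x y hxy)]
  have h := hcontr (Pi.single x 1) (Pi.single y 1)
    (fun a => by rw [Pi.single_apply]; split_ifs <;> norm_num)
    (fun b => by rw [Pi.single_apply]; split_ifs <;> norm_num)
    (by rw [sum_eq_single x (fun a _ ha => Pi.single_eq_of_ne ha _) (fun h => (h (mem_univ x)).elim),
      Pi.single_eq_same])
    (by rw [sum_eq_single y (fun a _ ha => Pi.single_eq_of_ne ha _) (fun h => (h (mem_univ y)).elim),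
      Pi.single_eq_same])
  rwa [stepLaw_single_eq_row, stepLaw_single_eq_row, transportDist_single_single] at h

/-- **PROPOSITION 2 (geodesic spaces: local curvature suffices).** Suppose every pair `x, y` is
joined by a chain `x = x₀, x₁, …, x_n = y` with `ρ(x_i,x_{i+1}) ≤ ε` and `Σ ρ(x_i,x_{i+1}) = ρ(x,y)`
("`ε`-geodesic"), `ρ` a metric and `P` row-stochastic.  If `κ(x,y) ≥ κ` whenever `0 < ρ(x,y) ≤ ε`,
then **`κ(x,y) ≥ κ` for all `x ≠ y`** ("since `W₁` is a distance, `W₁(m_x,m_y) ≤ ΣW₁(m_{x_i},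
m_{x_{i+1}}) ≤ (1 − κ)Σρ(x_i,x_{i+1})`"). Here `κ ≤ 1`. [cite: Ollivier2009, §2.1 Prop. 2] -/
theorem Ollivier2009_prop_2 (hP : IsRowStochastic P) (hρ : ∀ a b, 0 ≤ ρ a b) (hρ0 : ∀ a, ρ a a = 0)
    (hρpos : ∀ a b, a ≠ b → 0 < ρ a b) (hρt : ∀ x y z, ρ x z ≤ ρ x y + ρ y z) {ε κ : ℝ} (hκ1 : κ ≤ 1)
    (hgeo : ∀ x y, ∃ L, IsGraphPath (fun a b => ρ a b ≤ ε) ρ x y L ∧ L ≤ ρ x y)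
    (hloc : ∀ x y, x ≠ y → ρ x y ≤ ε → κ ≤ coarseRicci ρ P x y) {x y : X} (hxy : x ≠ y) :
    κ ≤ coarseRicci ρ P x y := by
  rw [le_coarseRicci_iff (hρpos x y hxy)]
  refine LevinPeres2017_eq_14_12 hP hρ hρ0 hρt (E := fun a b => ρ a b ≤ ε) (by linarith)
    (fun a b hab => ?_) hgeo x y
  obtain ⟨θ, hθ, hθe⟩ := exists_optimalCoupling ρ (hP.1 a) (hP.1 b) (hP.2 a) (hP.2 b)
  refine ⟨θ, hθ, ?_⟩
  rw [hθe]
  by_cases h : a = b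
  · subst h
    rw [transportDist_self hρ hρ0 (hP.1 a), hρ0, mul_zero]
  · exact (le_coarseRicci_iff (hρpos a b h) κ).1 (hloc a b h hab)

/-! ## Corollary 1: unique invariant law and exponential convergence in `W₁` -/

/-- **COROLLARY 1 (uniqueness).** If `κ(x,y) ≥ κ > 0` for all `x ≠ y` then the invariant
probability vector is unique. [cite: Ollivier2009, §2.2 Cor. 1 (first assertion)] -/
theorem Ollivier2009_cor_1_unique (hP : IsRowStochastic P) (hρ : ∀ a b, 0 ≤ ρ a b)
    (hρ0 : ∀ a, ρ a a = 0) (hρpos : ∀ a b, a ≠ b → 0 < ρ a b) {κ : ℝ} (hκ : 0 < κ)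
    (hκxy : ∀ x y, x ≠ y → κ ≤ coarseRicci ρ P x y) {ν ν' : X → ℝ} (hν : ∀ a, 0 ≤ ν a)
    (hν1 : ∑ a, ν a = 1) (hνP : IsStationary ν P) (hν' : ∀ a, 0 ≤ ν' a) (hν'1 : ∑ a, ν' a = 1)
    (hν'P : IsStationary ν' P) : ν = ν' := by
  -- `δ := min_{a ≠ b} ρ(a,b) > 0` bounds total variation by `W₁/δ`
  have hW : transportDist ρ ν ν' = 0 := by
    have h := Ollivier2009_prop_3 hP hρ hρ0 hρpos hκxy hν hν' hν1 hν'1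
    rw [stepLaw_eq_self_of_isStationary hνP, stepLaw_eq_self_of_isStationary hν'P] at h
    have h0 := transportDist_nonneg hρ ν ν'
    nlinarith
  by_cases hX : (univ.filter fun p : X × X => p.1 ≠ p.2).Nonempty
  · obtain ⟨p₀, hp₀, hmin⟩ := exists_min_image (univ.filter fun p : X × X => p.1 ≠ p.2)
      (fun p => ρ p.1 p.2) hX
    have hδ : 0 < ρ p₀.1 p₀.2 := hρpos _ _ (mem_filter.1 hp₀).2
    have htv := mul_tvDist_le_transportDist hρ hδ.le
      (fun a b hab => hmin (a, b) (mem_filter.2 ⟨mem_univ _, hab⟩)) hν hν' hν1 hν'1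
    rw [hW] at htv
    exact (tvDist_eq_zero_iff ν ν').1 (le_antisymm (by nlinarith [tvDist_nonneg ν ν']) (tvDist_nonneg ν ν'))
  · -- no pair of distinct points: `X` is a subsingleton
    funext a
    have hsub : ∀ b : X, b = a := fun b => by
      by_contra hba
      exact hX ⟨(b, a), mem_filter.2 ⟨mem_univ _, hba⟩⟩
    have h1 : ∑ b, ν b = ν a := by
      rw [sum_eq_single a (fun b _ hb => (hb (hsub b)).elim) (fun h => (h (mem_univ a)).elim)]
    have h2 : ∑ b, ν' b = ν' a := by
      rw [sum_eq_single a (fun b _ hb => (hb (hsub b)).elim) (fun h => (h (mem_univ a)).elim)]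
    rw [← h1, ← h2, hν1, hν'1]

/-- **COROLLARY 1 (convergence).** If `κ(x,y) ≥ κ` for all `x ≠ y` and `ν` is invariant, then for
every probability vector `μ`, **`W₁(μ∗m^{∗n}, ν) ≤ (1 − κ)ⁿ W₁(μ,ν)`** (`κ ≤ 1`).
[cite: Ollivier2009, §2.2 Cor. 1 (second assertion)] -/
theorem Ollivier2009_cor_1_convergence (hP : IsRowStochastic P) (hρ : ∀ a b, 0 ≤ ρ a b)
    (hρ0 : ∀ a, ρ a a = 0) (hρpos : ∀ a b, a ≠ b → 0 < ρ a b) {κ : ℝ} (hκ1 : κ ≤ 1)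
    (hκxy : ∀ x y, x ≠ y → κ ≤ coarseRicci ρ P x y) {μ ν : X → ℝ} (hμ : ∀ a, 0 ≤ μ a)
    (hμ1 : ∑ a, μ a = 1) (hν : ∀ a, 0 ≤ ν a) (hν1 : ∑ a, ν a = 1) (hνP : IsStationary ν P) (n : ℕ) :
    transportDist ρ (lawAt P μ n) ν ≤ (1 - κ) ^ n * transportDist ρ μ ν := by
  have h := transportDist_lawAt_le hP (by linarith)
    (fun a b ha hb ha1 hb1 => Ollivier2009_prop_3 hP hρ hρ0 hρpos hκxy ha hb ha1 hb1) hμ hν hμ1 hν1 n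
  rwa [lawAt_eq_self_of_isStationary hνP] at h

/-- **`W₁(δ_x, ν) ≤ J(x)/κ`** for the invariant `ν` when `κ(x,y) ≥ κ > 0`
("`W₁(δ_x,ν) ≤ W₁(δ_x,m_x) + W₁(m_x,ν) ≤ J(x) + (1 − κ)W₁(δ_x,ν)`"). [cite: Ollivier2009, §2.2
Cor. 1 (proof of the last assertion)] -/
theorem transportDist_single_invariant_le (hP : IsRowStochastic P) (hρ : ∀ a b, 0 ≤ ρ a b)
    (hρ0 : ∀ a, ρ a a = 0) (hρpos : ∀ a b, a ≠ b → 0 < ρ a b)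
    (hρt : ∀ x y z, ρ x z ≤ ρ x y + ρ y z) {κ : ℝ} (hκ : 0 < κ)
    (hκxy : ∀ x y, x ≠ y → κ ≤ coarseRicci ρ P x y) {ν : X → ℝ} (hν : ∀ a, 0 ≤ ν a)
    (hν1 : ∑ a, ν a = 1) (hνP : IsStationary ν P) (x : X) :
    transportDist ρ (Pi.single x 1) ν ≤ jump ρ P x / κ := by
  have hx : ∀ a, 0 ≤ (Pi.single x 1 : X → ℝ) a := fun a => by
    rw [Pi.single_apply]; split_ifs <;> norm_num
  have hx1 : ∑ a, (Pi.single x 1 : X → ℝ) a = 1 := by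
    rw [sum_eq_single x (fun a _ ha => Pi.single_eq_of_ne ha _) (fun h => (h (mem_univ x)).elim),
      Pi.single_eq_same]
  have htri := transportDist_triangle hρt hx (hP.1 x) hν hx1 (hP.2 x) hν1
  have hstep := Ollivier2009_prop_3 hP hρ hρ0 hρpos hκxy hx hν hx1 hν1
  rw [stepLaw_single_eq_row, stepLaw_eq_self_of_isStationary hνP] at hstep
  rw [le_div_iff₀ hκ]
  unfold jump
  nlinarith

/-- **COROLLARY 1 (pointwise form).** **`W₁(m_x^{∗n}, ν) ≤ (1 − κ)ⁿ J(x)/κ`** for `0 < κ ≤ 1`.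
[cite: Ollivier2009, §2.2 Cor. 1 (last display)] -/
theorem Ollivier2009_cor_1_pointwise (hP : IsRowStochastic P) (hρ : ∀ a b, 0 ≤ ρ a b)
    (hρ0 : ∀ a, ρ a a = 0) (hρpos : ∀ a b, a ≠ b → 0 < ρ a b)
    (hρt : ∀ x y z, ρ x z ≤ ρ x y + ρ y z) {κ : ℝ} (hκ : 0 < κ) (hκ1 : κ ≤ 1)
    (hκxy : ∀ x y, x ≠ y → κ ≤ coarseRicci ρ P x y) {ν : X → ℝ} (hν : ∀ a, 0 ≤ ν a)
    (hν1 : ∑ a, ν a = 1) (hνP : IsStationary ν P) (x : X) (n : ℕ) :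
    transportDist ρ (lawAt P (Pi.single x 1) n) ν ≤ (1 - κ) ^ n * (jump ρ P x / κ) := by
  have hx : ∀ a, 0 ≤ (Pi.single x 1 : X → ℝ) a := fun a => by
    rw [Pi.single_apply]; split_ifs <;> norm_num
  have hx1 : ∑ a, (Pi.single x 1 : X → ℝ) a = 1 := by
    rw [sum_eq_single x (fun a _ ha => Pi.single_eq_of_ne ha _) (fun h => (h (mem_univ x)).elim),
      Pi.single_eq_same]
  refine (Ollivier2009_cor_1_convergence hP hρ hρ0 hρpos hκ1 hκxy hx hx1 hν hν1 hνP n).trans ?_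
  exact mul_le_mul_of_nonneg_left
    (transportDist_single_invariant_le hP hρ hρ0 hρpos hρt hκ hκxy hν hν1 hνP x)
    (pow_nonneg (by linarith) n)

/-! ## Corollary 2: the bias of a Lipschitz observable -/

/-- **COROLLARY 2.** If `κ(x,y) ≥ κ > 0` for all `x ≠ y`, `ν` is invariant and `f` is 1-Lipschitz,
then for every probability vector `μ`: **`|E_ν f − E_μ f| ≤ W₁(μ, μ∗m)/κ`**.
[cite: Ollivier2009, §2.2 Cor. 2] -/
theorem Ollivier2009_cor_2 (hP : IsRowStochastic P) (hρ : ∀ a b, 0 ≤ ρ a b) (hρ0 : ∀ a, ρ a a = 0)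
    (hρpos : ∀ a b, a ≠ b → 0 < ρ a b) (hρt : ∀ x y z, ρ x z ≤ ρ x y + ρ y z) {κ : ℝ}
    (hκ : 0 < κ) (hκxy : ∀ x y, x ≠ y → κ ≤ coarseRicci ρ P x y) {ν : X → ℝ} (hν : ∀ a, 0 ≤ ν a)
    (hν1 : ∑ a, ν a = 1) (hνP : IsStationary ν P) {f : X → ℝ} (hf : ∀ a b, |f a - f b| ≤ ρ a b)
    {μ : X → ℝ} (hμ : ∀ a, 0 ≤ μ a) (hμ1 : ∑ a, μ a = 1) :
    |∑ a, ν a * f a - ∑ b, μ b * f b| ≤ transportDist ρ μ (stepLaw P μ) / κ := by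
  have hPμ : ∀ b, 0 ≤ stepLaw P μ b := stepLaw_nonneg hP hμ
  have hPμ1 : ∑ b, stepLaw P μ b = 1 := by rw [sum_stepLaw hP, hμ1]
  -- `W₁(μ,ν) ≤ W₁(μ,μ∗m) + W₁(μ∗m, ν∗m) ≤ W₁(μ,μ∗m) + (1 − κ)W₁(μ,ν)`
  have htri := transportDist_triangle hρt hμ hPμ hν hμ1 hPμ1 hν1
  have hstep := Ollivier2009_prop_3 hP hρ hρ0 hρpos hκxy hμ hν hμ1 hν1
  rw [stepLaw_eq_self_of_isStationary hνP] at hstep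
  have hW : transportDist ρ μ ν ≤ transportDist ρ μ (stepLaw P μ) / κ := by
    rw [le_div_iff₀ hκ]; nlinarith
  have hlip := abs_lawMean_sub_le_transportDist (L := 1) (fun a b => by rw [one_mul]; exact hf a b)
    (couplings_nonempty hμ hν hμ1 hν1) (ρ := ρ)
  rw [one_mul, abs_sub_comm] at hlip
  exact hlip.trans hW

/-- **COROLLARY 2 (pointwise).** **`|f(x) − E_ν f| ≤ J(x)/κ`** ("simply the case when `μ` is the
Dirac measure at `x`"). [cite: Ollivier2009, §2.2 Cor. 2 (last assertion)] -/
theorem Ollivier2009_cor_2_pointwise (hP : IsRowStochastic P) (hρ : ∀ a b, 0 ≤ ρ a b)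
    (hρ0 : ∀ a, ρ a a = 0) (hρpos : ∀ a b, a ≠ b → 0 < ρ a b)
    (hρt : ∀ x y z, ρ x z ≤ ρ x y + ρ y z) {κ : ℝ} (hκ : 0 < κ)
    (hκxy : ∀ x y, x ≠ y → κ ≤ coarseRicci ρ P x y) {ν : X → ℝ} (hν : ∀ a, 0 ≤ ν a)
    (hν1 : ∑ a, ν a = 1) (hνP : IsStationary ν P) {f : X → ℝ} (hf : ∀ a b, |f a - f b| ≤ ρ a b)
    (x : X) : |f x - ∑ a, ν a * f a| ≤ jump ρ P x / κ := by
  have hx : ∀ a, 0 ≤ (Pi.single x 1 : X → ℝ) a := fun a => by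
    rw [Pi.single_apply]; split_ifs <;> norm_num
  have hx1 : ∑ a, (Pi.single x 1 : X → ℝ) a = 1 := by
    rw [sum_eq_single x (fun a _ ha => Pi.single_eq_of_ne ha _) (fun h => (h (mem_univ x)).elim),
      Pi.single_eq_same]
  have h := Ollivier2009_cor_2 hP hρ hρ0 hρpos hρt hκ hκxy hν hν1 hνP hf hx hx1
  have hfx : ∑ b, (Pi.single x 1 : X → ℝ) b * f b = f x := by
    rw [sum_eq_single x (fun b _ hb => by rw [Pi.single_eq_of_ne hb, zero_mul])
      (fun h => (h (mem_univ x)).elim), Pi.single_eq_same, one_mul]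
  rw [hfx, stepLaw_single_eq_row, abs_sub_comm] at h
  exact h

/-! ## Propositions 4–5: `L¹` Bonnet–Myers -/

/-- **PROPOSITION 4 (`L¹` Bonnet–Myers).** For every `x ≠ y`, **`κ(x,y)·ρ(x,y) ≤ J(x) + J(y)`**
(i.e. `ρ(x,y) ≤ (J(x) + J(y))/κ(x,y)` when `κ(x,y) > 0`): `ρ(x,y) = W₁(δ_x,δ_y) ≤ J(x) +
W₁(m_x,m_y) + J(y)`. [cite: Ollivier2009, §2.3 Prop. 4] -/
theorem Ollivier2009_prop_4 (hP : IsRowStochastic P) (hρs : ∀ x y, ρ x y = ρ y x)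
    (hρt : ∀ x y z, ρ x z ≤ ρ x y + ρ y z) (hρpos : ∀ a b, a ≠ b → 0 < ρ a b) {x y : X}
    (hxy : x ≠ y) : coarseRicci ρ P x y * ρ x y ≤ jump ρ P x + jump ρ P y := by
  have hx : ∀ a, 0 ≤ (Pi.single x 1 : X → ℝ) a := fun a => by
    rw [Pi.single_apply]; split_ifs <;> norm_num
  have hx1 : ∑ a, (Pi.single x 1 : X → ℝ) a = 1 := by
    rw [sum_eq_single x (fun a _ ha => Pi.single_eq_of_ne ha _) (fun h => (h (mem_univ x)).elim),
      Pi.single_eq_same]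
  have hy : ∀ a, 0 ≤ (Pi.single y 1 : X → ℝ) a := fun a => by
    rw [Pi.single_apply]; split_ifs <;> norm_num
  have hy1 : ∑ a, (Pi.single y 1 : X → ℝ) a = 1 := by
    rw [sum_eq_single y (fun a _ ha => Pi.single_eq_of_ne ha _) (fun h => (h (mem_univ y)).elim),
      Pi.single_eq_same]
  have h1 := transportDist_triangle hρt hx (hP.1 x) hy hx1 (hP.2 x) hy1
  have h2 := transportDist_triangle hρt (hP.1 x) (hP.1 y) hy (hP.2 x) (hP.2 y) hy1
  rw [transportDist_single_single] at h1
  have h3 : transportDist ρ (P y) (Pi.single y 1) = jump ρ P y := by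
    unfold jump; exact transportDist_comm hρs _ _
  rw [h3] at h2
  unfold coarseRicci jump at *
  have hρxy := hρpos x y hxy
  rw [sub_mul, div_mul_cancel₀ _ hρxy.ne', one_mul]
  linarith

/-- **PROPOSITION 5 (average `L¹` Bonnet–Myers).** With `κ(x,y) ≥ κ > 0` for all `x ≠ y` and `ν`
invariant: **`∫ρ(x,y)dν(y) = W₁(δ_x,ν) ≤ J(x)/κ`** for every `x`. [cite: Ollivier2009, §2.3 Prop. 5
(first assertion)] -/
theorem Ollivier2009_prop_5 (hP : IsRowStochastic P) (hρ : ∀ a b, 0 ≤ ρ a b) (hρ0 : ∀ a, ρ a a = 0)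
    (hρpos : ∀ a b, a ≠ b → 0 < ρ a b) (hρt : ∀ x y z, ρ x z ≤ ρ x y + ρ y z) {κ : ℝ}
    (hκ : 0 < κ) (hκxy : ∀ x y, x ≠ y → κ ≤ coarseRicci ρ P x y) {ν : X → ℝ} (hν : ∀ a, 0 ≤ ν a)
    (hν1 : ∑ a, ν a = 1) (hνP : IsStationary ν P) (x : X) :
    ∑ y, ρ x y * ν y ≤ jump ρ P x / κ := by
  rw [← transportDist_single_left ρ x hν hν1]
  exact transportDist_single_invariant_le hP hρ hρ0 hρpos hρt hκ hκxy hν hν1 hνP x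

/-- **PROPOSITION 5 (second assertion).** **`∫∫ρ(y,z)dν(y)dν(z) ≤ 2J(x₀)/κ`** for every `x₀` (so
`≤ 2 inf_x J(x)/κ`). [cite: Ollivier2009, §2.3 Prop. 5 (second assertion and its proof)] -/
theorem Ollivier2009_prop_5_pair (hP : IsRowStochastic P) (hρ : ∀ a b, 0 ≤ ρ a b)
    (hρ0 : ∀ a, ρ a a = 0) (hρpos : ∀ a b, a ≠ b → 0 < ρ a b) (hρs : ∀ x y, ρ x y = ρ y x)
    (hρt : ∀ x y z, ρ x z ≤ ρ x y + ρ y z) {κ : ℝ} (hκ : 0 < κ)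
    (hκxy : ∀ x y, x ≠ y → κ ≤ coarseRicci ρ P x y) {ν : X → ℝ} (hν : ∀ a, 0 ≤ ν a)
    (hν1 : ∑ a, ν a = 1) (hνP : IsStationary ν P) (x₀ : X) :
    ∑ y, ∑ z, ρ y z * (ν y * ν z) ≤ 2 * (jump ρ P x₀ / κ) := by
  have h5 := Ollivier2009_prop_5 hP hρ hρ0 hρpos hρt hκ hκxy hν hν1 hνP x₀
  calc ∑ y, ∑ z, ρ y z * (ν y * ν z) ≤ ∑ y, ∑ z, (ρ y x₀ + ρ x₀ z) * (ν y * ν z) :=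
        sum_le_sum fun y _ => sum_le_sum fun z _ =>
          mul_le_mul_of_nonneg_right (hρt y x₀ z) (mul_nonneg (hν y) (hν z))
    _ = (∑ y, ρ x₀ y * ν y) * (∑ z, ν z) + (∑ y, ν y) * ∑ z, ρ x₀ z * ν z := by
        simp_rw [add_mul, sum_add_distrib]
        congr 1
        · rw [sum_mul]
          refine sum_congr rfl fun y _ => ?_
          rw [mul_sum, hρs y x₀]
          exact sum_congr rfl fun z _ => by ring
        · rw [sum_mul]
          refine sum_congr rfl fun y _ => ?_
          rw [mul_sum]
          exact sum_congr rfl fun z _ => by ring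
    _ = 2 * ∑ y, ρ x₀ y * ν y := by rw [hν1, mul_one, one_mul, two_mul]
    _ ≤ 2 * (jump ρ P x₀ / κ) := by linarith

end Contraction

/-! ## §2.4, Proposition 6: superposition -/

section Superposition

variable {I : Type*} [Fintype I]

omit [DecidableEq X] in
/-- A convex combination of couplings of `(μ_i, ν_i)` is a coupling of the mixtures
`(Σ α_i μ_i, Σ α_i ν_i)` ("`Σ α_i ξ_i` is a coupling between `Σ α_i m_x^{(i)}` and `Σ α_i m_y^{(i)}`").
[cite: Ollivier2009, §2.4 Prop. 6 (proof, first sentence)] -/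
theorem isCoupling_mixture {α : I → ℝ} (hα0 : ∀ i, 0 ≤ α i) {μ ν : I → X → ℝ}
    {q : I → X → X → ℝ} (hq : ∀ i, IsCoupling (μ i) (ν i) (q i)) :
    IsCoupling (fun a => ∑ i, α i * μ i a) (fun b => ∑ i, α i * ν i b)
      (fun a b => ∑ i, α i * q i a b) := by
  refine ⟨fun a b => sum_nonneg fun i _ => mul_nonneg (hα0 i) ((hq i).1 a b), fun a => ?_,
    fun b => ?_⟩
  · show ∑ b, ∑ i, α i * q i a b = ∑ i, α i * μ i a
    rw [sum_comm]
    exact sum_congr rfl fun i _ => by rw [← mul_sum, (hq i).2.1 a]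
  · show ∑ a, ∑ i, α i * q i a b = ∑ i, α i * ν i b
    rw [sum_comm]
    exact sum_congr rfl fun i _ => by rw [← mul_sum, (hq i).2.2 b]

omit [DecidableEq X] in
/-- **`W₁(Σ α_i μ_i, Σ α_i ν_i) ≤ Σ α_i W₁(μ_i, ν_i)`** for probability vectors `μ_i, ν_i` and convex
weights `α` (couple each pair optimally and mix). [cite: Ollivier2009, §2.4 Prop. 6 (proof, first
display)] -/
theorem transportDist_mixture_le (ρ : X → X → ℝ) {α : I → ℝ} (hα0 : ∀ i, 0 ≤ α i)
    {μ ν : I → X → ℝ} (hμ : ∀ i a, 0 ≤ μ i a) (hν : ∀ i b, 0 ≤ ν i b) (hμ1 : ∀ i, ∑ a, μ i a = 1)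
    (hν1 : ∀ i, ∑ b, ν i b = 1) :
    transportDist ρ (fun a => ∑ i, α i * μ i a) (fun b => ∑ i, α i * ν i b) ≤
      ∑ i, α i * transportDist ρ (μ i) (ν i) := by
  classical
  -- optimal couplings `q_i`
  have hex : ∀ i, ∃ q, IsCoupling (μ i) (ν i) q ∧ transportCost ρ q = transportDist ρ (μ i) (ν i) :=
    fun i => exists_optimalCoupling ρ (hμ i) (hν i) (hμ1 i) (hν1 i)
  choose q hq hcost using hex
  refine (transportDist_le (isCoupling_mixture hα0 hq)).trans (le_of_eq ?_)
  simp_rw [← hcost]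
  unfold transportCost
  have e : ∀ a b, ρ a b * ∑ i, α i * q i a b = ∑ i, α i * (ρ a b * q i a b) := fun a b => by
    rw [mul_sum]; exact sum_congr rfl fun i _ => by ring
  simp_rw [e]
  calc ∑ a, ∑ b, ∑ i, α i * (ρ a b * q i a b)
      = ∑ a, ∑ i, ∑ b, α i * (ρ a b * q i a b) := sum_congr rfl fun a _ => sum_comm
    _ = ∑ i, ∑ a, ∑ b, α i * (ρ a b * q i a b) := sum_comm
    _ = ∑ i, α i * ∑ a, ∑ b, ρ a b * q i a b := by simp_rw [mul_sum]

omit [DecidableEq X] in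
/-- **PROPOSITION 6 (Superposition).** If each random walk `m^{(i)}` has coarse Ricci curvature at
least `κ_i` (in the direction `(x,y)`), and `m_x := Σ α_i m_x^{(i)}` with convex weights `α`, then the
curvature of `m` is at least `Σ α_i κ_i`: "`W₁(m_x,m_y) ≤ Σ α_i W₁(m_x^{(i)}, m_y^{(i)}) ≤
Σ α_i (1 − κ_i) d(x,y) = (1 − Σ α_iκ_i) d(x,y)`". [cite: Ollivier2009, §2.4 Prop. 6] -/
theorem Ollivier2009_prop_6 {ρ : X → X → ℝ} {α : I → ℝ} (hα0 : ∀ i, 0 ≤ α i) (hα1 : ∑ i, α i = 1)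
    {P : I → X → X → ℝ} (hP : ∀ i, IsRowStochastic (P i)) {κ : I → ℝ} {x y : X}
    (hxy : 0 < ρ x y) (h : ∀ i, κ i ≤ coarseRicci ρ (P i) x y) :
    ∑ i, α i * κ i ≤ coarseRicci ρ (fun a b => ∑ i, α i * P i a b) x y := by
  rw [le_coarseRicci_iff hxy]
  have hi : ∀ i, transportDist ρ (P i x) (P i y) ≤ (1 - κ i) * ρ x y :=
    fun i => (le_coarseRicci_iff hxy (κ i)).1 (h i)
  calc transportDist ρ (fun a => ∑ i, α i * P i x a) (fun b => ∑ i, α i * P i y b)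
      ≤ ∑ i, α i * transportDist ρ (P i x) (P i y) :=
        transportDist_mixture_le ρ hα0 (fun i a => (hP i).1 x a) (fun i b => (hP i).1 y b)
          (fun i => (hP i).2 x) (fun i => (hP i).2 y)
    _ ≤ ∑ i, α i * ((1 - κ i) * ρ x y) :=
        sum_le_sum fun i _ => mul_le_mul_of_nonneg_left (hi i) (hα0 i)
    _ = (1 - ∑ i, α i * κ i) * ρ x y := by
        have e : ∀ i, α i * ((1 - κ i) * ρ x y) = (α i - α i * κ i) * ρ x y := fun i => by ring
        simp_rw [e]
        rw [← sum_mul, sum_sub_distrib, hα1]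

end Superposition

/-! ## §2.4, Proposition 7: `L¹` tensorization (two factors) -/

section Tensorization

variable {X₁ X₂ : Type*} [Fintype X₁] [DecidableEq X₁] [Fintype X₂] [DecidableEq X₂]

/-- The `L¹` (sum) distance `d = d₁ + d₂` on `X₁ × X₂`. [cite: Ollivier2009, §2.4 Prop. 7 ("equipped
with the distance `Σ d_i`")] -/
def sumDist (ρ₁ : X₁ → X₁ → ℝ) (ρ₂ : X₂ → X₂ → ℝ) (a b : X₁ × X₂) : ℝ := ρ₁ a.1 b.1 + ρ₂ a.2 b.2

/-- `m̃^{(1)}_x = m¹_{x₁} ⊗ δ_{x₂}`: move the first coordinate by `P₁`, freeze the second.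
[cite: Ollivier2009, §2.4 Prop. 7 (the walks `m̃^{(i)}_x`)] -/
def liftFst (P₁ : X₁ → X₁ → ℝ) (x y : X₁ × X₂) : ℝ := if y.2 = x.2 then P₁ x.1 y.1 else 0

/-- `m̃^{(2)}_x = δ_{x₁} ⊗ m²_{x₂}`. [cite: Ollivier2009, §2.4 Prop. 7] -/
def liftSnd (P₂ : X₂ → X₂ → ℝ) (x y : X₁ × X₂) : ℝ := if y.1 = x.1 then P₂ x.2 y.2 else 0

/-- The product random walk `m_x = α m¹_{x₁} ⊗ δ_{x₂} + (1 − α) δ_{x₁} ⊗ m²_{x₂}` (two factors).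
[cite: Ollivier2009, §2.4 Prop. 7 (the display defining `m_{(x_i)}`)] -/
def tensorWalk (α : ℝ) (P₁ : X₁ → X₁ → ℝ) (P₂ : X₂ → X₂ → ℝ) (x y : X₁ × X₂) : ℝ :=
  α * liftFst P₁ x y + (1 - α) * liftSnd P₂ x y

omit [DecidableEq X₁] in
/-- `m̃^{(1)}` is a random walk (rows are probability vectors). [cite: Ollivier2009, §2.4 Prop. 7] -/
theorem liftFst_isRowStochastic {P₁ : X₁ → X₁ → ℝ} (hP₁ : IsRowStochastic P₁) :
    IsRowStochastic (liftFst (X₂ := X₂) P₁) := by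
  refine ⟨fun a b => ?_, fun a => ?_⟩
  · unfold liftFst; split_ifs; exacts [hP₁.1 _ _, le_refl _]
  · unfold liftFst
    rw [Fintype.sum_prod_type]
    dsimp only
    simp_rw [sum_ite_eq' univ a.2, if_pos (mem_univ _)]
    exact hP₁.2 a.1

omit [DecidableEq X₂] in
/-- `m̃^{(2)}` is a random walk. [cite: Ollivier2009, §2.4 Prop. 7] -/
theorem liftSnd_isRowStochastic {P₂ : X₂ → X₂ → ℝ} (hP₂ : IsRowStochastic P₂) :
    IsRowStochastic (liftSnd (X₁ := X₁) P₂) := by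
  refine ⟨fun a b => ?_, fun a => ?_⟩
  · unfold liftSnd; split_ifs; exacts [hP₂.1 _ _, le_refl _]
  · unfold liftSnd
    rw [Fintype.sum_prod_type, sum_comm]
    dsimp only
    simp_rw [sum_ite_eq' univ a.1, if_pos (mem_univ _)]
    exact hP₂.2 a.2

omit [DecidableEq X₁] in
/-- **`W₁(m¹_{x₁} ⊗ δ_{x₂}, m¹_{y₁} ⊗ δ_{y₂}) ≤ W₁(m¹_{x₁}, m¹_{y₁}) + d₂(x₂,y₂)`** (couple the moving
coordinates optimally; the frozen ones sit at `x₂`, `y₂`). [cite: Ollivier2009, §2.4 Prop. 7 (proof,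
second inequality)] -/
theorem transportDist_liftFst_le (ρ₁ : X₁ → X₁ → ℝ) (ρ₂ : X₂ → X₂ → ℝ) {P₁ : X₁ → X₁ → ℝ}
    (hP₁ : IsRowStochastic P₁) (x y : X₁ × X₂) :
    transportDist (sumDist ρ₁ ρ₂) (liftFst P₁ x) (liftFst P₁ y) ≤
      transportDist ρ₁ (P₁ x.1) (P₁ y.1) + ρ₂ x.2 y.2 := by
  obtain ⟨q₁, hq₁, hcost⟩ := exists_optimalCoupling ρ₁ (hP₁.1 x.1) (hP₁.1 y.1) (hP₁.2 x.1) (hP₁.2 y.1)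
  let q : X₁ × X₂ → X₁ × X₂ → ℝ := fun a b => if a.2 = x.2 then (if b.2 = y.2 then q₁ a.1 b.1 else 0) else 0
  have hqc : IsCoupling (liftFst P₁ x) (liftFst P₁ y) q := by
    refine ⟨fun a b => ?_, fun a => ?_, fun b => ?_⟩
    · show 0 ≤ (if a.2 = x.2 then (if b.2 = y.2 then q₁ a.1 b.1 else 0) else 0)
      split_ifs; exacts [hq₁.1 a.1 b.1, le_refl _, le_refl _]
    · show ∑ b : X₁ × X₂, (if a.2 = x.2 then (if b.2 = y.2 then q₁ a.1 b.1 else 0) else 0) =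
        liftFst P₁ x a
      unfold liftFst
      by_cases ha : a.2 = x.2
      · simp_rw [if_pos ha]
        rw [Fintype.sum_prod_type]
        dsimp only
        simp_rw [sum_ite_eq' univ y.2, if_pos (mem_univ _)]
        exact hq₁.2.1 a.1
      · simp_rw [if_neg ha]; exact sum_const_zero
    · show ∑ a : X₁ × X₂, (if a.2 = x.2 then (if b.2 = y.2 then q₁ a.1 b.1 else 0) else 0) =
        liftFst P₁ y b
      unfold liftFst
      by_cases hb : b.2 = y.2
      · simp_rw [if_pos hb]
        rw [Fintype.sum_prod_type]
        dsimp only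
        simp_rw [sum_ite_eq' univ x.2, if_pos (mem_univ _)]
        exact hq₁.2.2 b.1
      · simp_rw [if_neg hb, ite_self]; exact sum_const_zero
  refine (transportDist_le hqc).trans (le_of_eq ?_)
  -- the cost of `q`: `Σ_{a₁,b₁} (ρ₁(a₁,b₁) + ρ₂(x₂,y₂)) q₁(a₁,b₁) = cost(q₁) + ρ₂(x₂,y₂)`
  have hmass : ∑ a₁, ∑ b₁, q₁ a₁ b₁ = 1 := by
    rw [show ∑ a₁, ∑ b₁, q₁ a₁ b₁ = ∑ a₁, P₁ x.1 a₁ from sum_congr rfl fun a₁ _ => hq₁.2.1 a₁, hP₁.2]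
  unfold transportCost
  calc ∑ a, ∑ b, sumDist ρ₁ ρ₂ a b * q a b
      = ∑ a₁, ∑ b₁, (ρ₁ a₁ b₁ + ρ₂ x.2 y.2) * q₁ a₁ b₁ := by
        show ∑ a : X₁ × X₂, ∑ b : X₁ × X₂, sumDist ρ₁ ρ₂ a b *
          (if a.2 = x.2 then (if b.2 = y.2 then q₁ a.1 b.1 else 0) else 0) = _
        rw [Fintype.sum_prod_type]
        refine sum_congr rfl fun a₁ _ => ?_
        rw [sum_comm]
        dsimp only
        simp only [mul_ite, mul_zero]
        simp_rw [sum_ite_eq' univ x.2, if_pos (mem_univ _)]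
        rw [Fintype.sum_prod_type]
        dsimp only
        simp_rw [sum_ite_eq' univ y.2, if_pos (mem_univ _)]
        rfl
    _ = ∑ a₁, ∑ b₁, ρ₁ a₁ b₁ * q₁ a₁ b₁ + ρ₂ x.2 y.2 * ∑ a₁, ∑ b₁, q₁ a₁ b₁ := by
        rw [mul_sum, ← sum_add_distrib]
        exact sum_congr rfl fun a₁ _ => by
          rw [mul_sum, ← sum_add_distrib]; exact sum_congr rfl fun b₁ _ => by ring
    _ = transportDist ρ₁ (P₁ x.1) (P₁ y.1) + ρ₂ x.2 y.2 := by
        rw [hmass, mul_one, ← hcost]; rfl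

omit [DecidableEq X₂] in
/-- The mirror statement for the second factor: `W₁(δ_{x₁} ⊗ m²_{x₂}, δ_{y₁} ⊗ m²_{y₂}) ≤
d₁(x₁,y₁) + W₁(m²_{x₂}, m²_{y₂})`. [cite: Ollivier2009, §2.4 Prop. 7 (proof, second inequality)] -/
theorem transportDist_liftSnd_le (ρ₁ : X₁ → X₁ → ℝ) (ρ₂ : X₂ → X₂ → ℝ) {P₂ : X₂ → X₂ → ℝ}
    (hP₂ : IsRowStochastic P₂) (x y : X₁ × X₂) :
    transportDist (sumDist ρ₁ ρ₂) (liftSnd P₂ x) (liftSnd P₂ y) ≤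
      ρ₁ x.1 y.1 + transportDist ρ₂ (P₂ x.2) (P₂ y.2) := by
  obtain ⟨q₂, hq₂, hcost⟩ := exists_optimalCoupling ρ₂ (hP₂.1 x.2) (hP₂.1 y.2) (hP₂.2 x.2) (hP₂.2 y.2)
  let q : X₁ × X₂ → X₁ × X₂ → ℝ := fun a b => if a.1 = x.1 then (if b.1 = y.1 then q₂ a.2 b.2 else 0) else 0
  have hqc : IsCoupling (liftSnd P₂ x) (liftSnd P₂ y) q := by
    refine ⟨fun a b => ?_, fun a => ?_, fun b => ?_⟩
    · show 0 ≤ (if a.1 = x.1 then (if b.1 = y.1 then q₂ a.2 b.2 else 0) else 0)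
      split_ifs; exacts [hq₂.1 a.2 b.2, le_refl _, le_refl _]
    · show ∑ b : X₁ × X₂, (if a.1 = x.1 then (if b.1 = y.1 then q₂ a.2 b.2 else 0) else 0) =
        liftSnd P₂ x a
      unfold liftSnd
      by_cases ha : a.1 = x.1
      · simp_rw [if_pos ha]
        rw [Fintype.sum_prod_type, sum_comm]
        dsimp only
        simp_rw [sum_ite_eq' univ y.1, if_pos (mem_univ _)]
        exact hq₂.2.1 a.2
      · simp_rw [if_neg ha]; exact sum_const_zero
    · show ∑ a : X₁ × X₂, (if a.1 = x.1 then (if b.1 = y.1 then q₂ a.2 b.2 else 0) else 0) =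
        liftSnd P₂ y b
      unfold liftSnd
      by_cases hb : b.1 = y.1
      · simp_rw [if_pos hb]
        rw [Fintype.sum_prod_type, sum_comm]
        dsimp only
        simp_rw [sum_ite_eq' univ x.1, if_pos (mem_univ _)]
        exact hq₂.2.2 b.2
      · simp_rw [if_neg hb, ite_self]; exact sum_const_zero
  refine (transportDist_le hqc).trans (le_of_eq ?_)
  have hmass : ∑ a₂, ∑ b₂, q₂ a₂ b₂ = 1 := by
    rw [show ∑ a₂, ∑ b₂, q₂ a₂ b₂ = ∑ a₂, P₂ x.2 a₂ from sum_congr rfl fun a₂ _ => hq₂.2.1 a₂, hP₂.2]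
  unfold transportCost
  calc ∑ a, ∑ b, sumDist ρ₁ ρ₂ a b * q a b
      = ∑ a₂, ∑ b₂, (ρ₁ x.1 y.1 + ρ₂ a₂ b₂) * q₂ a₂ b₂ := by
        show ∑ a : X₁ × X₂, ∑ b : X₁ × X₂, sumDist ρ₁ ρ₂ a b *
          (if a.1 = x.1 then (if b.1 = y.1 then q₂ a.2 b.2 else 0) else 0) = _
        rw [Fintype.sum_prod_type, sum_comm]
        refine sum_congr rfl fun a₂ _ => ?_
        rw [sum_comm]
        dsimp only
        simp only [mul_ite, mul_zero]
        simp_rw [sum_ite_eq' univ x.1, if_pos (mem_univ _)]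
        rw [Fintype.sum_prod_type, sum_comm]
        dsimp only
        simp_rw [sum_ite_eq' univ y.1, if_pos (mem_univ _)]
        rfl
    _ = ρ₁ x.1 y.1 * ∑ a₂, ∑ b₂, q₂ a₂ b₂ + ∑ a₂, ∑ b₂, ρ₂ a₂ b₂ * q₂ a₂ b₂ := by
        rw [mul_sum, ← sum_add_distrib]
        exact sum_congr rfl fun a₂ _ => by
          rw [mul_sum, ← sum_add_distrib]; exact sum_congr rfl fun b₂ _ => by ring
    _ = ρ₁ x.1 y.1 + transportDist ρ₂ (P₂ x.2) (P₂ y.2) := by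
        rw [hmass, mul_one, ← hcost]; rfl

/-- **PROPOSITION 7 (`L¹` tensorization, two factors).** If `m^{(1)}`, `m^{(2)}` have coarse Ricci
curvature at least `κ₁`, `κ₂` (for distances `d₁`, `d₂` vanishing exactly on the diagonal), then the
walk `m_x = α m¹_{x₁} ⊗ δ_{x₂} + (1−α) δ_{x₁} ⊗ m²_{x₂}` on `(X₁ × X₂, d₁ + d₂)` has curvature at least
`min(ακ₁, (1−α)κ₂)`: "`W₁(m_x,m_y) ≤ Σ α_i W₁(m̃^{(i)}_x, m̃^{(i)}_y) ≤ Σ α_i((1−κ_i)d_i + Σ_{j≠i} d_j) =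
Σ d_i − Σ α_iκ_i d_i ≤ (1 − inf α_iκ_i) d(x,y)`". [cite: Ollivier2009, §2.4 Prop. 7]
-- TODO(general form): finite families `(X_1,…,X_k)`; the book-keeping is identical.
-/
theorem Ollivier2009_prop_7 {ρ₁ : X₁ → X₁ → ℝ} {ρ₂ : X₂ → X₂ → ℝ} (hρ₁ : ∀ a b, 0 ≤ ρ₁ a b)
    (hρ₂ : ∀ a b, 0 ≤ ρ₂ a b) (hρ₁0 : ∀ a, ρ₁ a a = 0) (hρ₂0 : ∀ a, ρ₂ a a = 0)
    (hρ₁pos : ∀ a b, a ≠ b → 0 < ρ₁ a b) (hρ₂pos : ∀ a b, a ≠ b → 0 < ρ₂ a b)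
    {P₁ : X₁ → X₁ → ℝ} {P₂ : X₂ → X₂ → ℝ} (hP₁ : IsRowStochastic P₁) (hP₂ : IsRowStochastic P₂)
    {α : ℝ} (hα0 : 0 ≤ α) (hα1 : α ≤ 1) {κ₁ κ₂ : ℝ}
    (h₁ : ∀ a b, a ≠ b → κ₁ ≤ coarseRicci ρ₁ P₁ a b) (h₂ : ∀ a b, a ≠ b → κ₂ ≤ coarseRicci ρ₂ P₂ a b)
    {x y : X₁ × X₂} (hxy : x ≠ y) :
    min (α * κ₁) ((1 - α) * κ₂) ≤ coarseRicci (sumDist ρ₁ ρ₂) (tensorWalk α P₁ P₂) x y := by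
  have hd : 0 < sumDist ρ₁ ρ₂ x y := by
    unfold sumDist
    rcases Decidable.em (x.1 = y.1) with h1 | h1
    · have h2 : x.2 ≠ y.2 := fun h2 => hxy (Prod.ext h1 h2)
      rw [h1, hρ₁0, zero_add]; exact hρ₂pos _ _ h2
    · exact add_pos_of_pos_of_nonneg (hρ₁pos _ _ h1) (hρ₂ _ _)
  rw [le_coarseRicci_iff hd]
  -- factor bounds `W₁(m^i_{x_i}, m^i_{y_i}) ≤ (1 − κ_i) d_i(x_i, y_i)` (trivial on the diagonal)
  have hW₁ : transportDist ρ₁ (P₁ x.1) (P₁ y.1) ≤ (1 - κ₁) * ρ₁ x.1 y.1 := by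
    rcases Decidable.em (x.1 = y.1) with h | h
    · rw [h, transportDist_self hρ₁ hρ₁0 (hP₁.1 y.1), hρ₁0, mul_zero]
    · exact (le_coarseRicci_iff (hρ₁pos _ _ h) κ₁).1 (h₁ _ _ h)
  have hW₂ : transportDist ρ₂ (P₂ x.2) (P₂ y.2) ≤ (1 - κ₂) * ρ₂ x.2 y.2 := by
    rcases Decidable.em (x.2 = y.2) with h | h
    · rw [h, transportDist_self hρ₂ hρ₂0 (hP₂.1 y.2), hρ₂0, mul_zero]
    · exact (le_coarseRicci_iff (hρ₂pos _ _ h) κ₂).1 (h₂ _ _ h)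
  -- the mixture step with index set `Bool` (`true ↦ (α, m̃¹)`, `false ↦ (1−α, m̃²)`)
  have hl₁ := liftFst_isRowStochastic (X₂ := X₂) hP₁
  have hl₂ := liftSnd_isRowStochastic (X₁ := X₁) hP₂
  have h1α : 0 ≤ 1 - α := by linarith
  have hmix := transportDist_mixture_le (I := Bool) (sumDist ρ₁ ρ₂)
    (α := fun i => bif i then α else 1 - α)
    (fun i => by cases i; exacts [h1α, hα0])
    (μ := fun i => bif i then liftFst P₁ x else liftSnd P₂ x)
    (ν := fun i => bif i then liftFst P₁ y else liftSnd P₂ y)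
    (fun i a => by cases i; exacts [hl₂.1 x a, hl₁.1 x a])
    (fun i b => by cases i; exacts [hl₂.1 y b, hl₁.1 y b])
    (fun i => by cases i; exacts [hl₂.2 x, hl₁.2 x]) (fun i => by cases i; exacts [hl₂.2 y, hl₁.2 y])
  simp only [Fintype.sum_bool, Bool.cond_true, Bool.cond_false] at hmix
  have ex : (fun a => α * liftFst P₁ x a + (1 - α) * liftSnd P₂ x a) = tensorWalk α P₁ P₂ x := by
    funext a; rfl
  have ey : (fun b => α * liftFst P₁ y b + (1 - α) * liftSnd P₂ y b) = tensorWalk α P₁ P₂ y := by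
    funext b; rfl
  rw [ex, ey] at hmix
  have hA := transportDist_liftFst_le ρ₁ ρ₂ hP₁ x y
  have hB := transportDist_liftSnd_le ρ₁ ρ₂ hP₂ x y
  have hmin₁ : min (α * κ₁) ((1 - α) * κ₂) * ρ₁ x.1 y.1 ≤ α * κ₁ * ρ₁ x.1 y.1 :=
    mul_le_mul_of_nonneg_right (min_le_left _ _) (hρ₁ _ _)
  have hmin₂ : min (α * κ₁) ((1 - α) * κ₂) * ρ₂ x.2 y.2 ≤ (1 - α) * κ₂ * ρ₂ x.2 y.2 :=
    mul_le_mul_of_nonneg_right (min_le_right _ _) (hρ₂ _ _)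
  have hA' := mul_le_mul_of_nonneg_left (hA.trans (add_le_add hW₁ le_rfl)) hα0
  have hB' := mul_le_mul_of_nonneg_left (hB.trans (add_le_add le_rfl hW₂)) h1α
  calc transportDist (sumDist ρ₁ ρ₂) (tensorWalk α P₁ P₂ x) (tensorWalk α P₁ P₂ y)
      ≤ α * transportDist (sumDist ρ₁ ρ₂) (liftFst P₁ x) (liftFst P₁ y) +
          (1 - α) * transportDist (sumDist ρ₁ ρ₂) (liftSnd P₂ x) (liftSnd P₂ y) := hmix
    _ ≤ α * ((1 - κ₁) * ρ₁ x.1 y.1 + ρ₂ x.2 y.2) + (1 - α) * (ρ₁ x.1 y.1 + (1 - κ₂) * ρ₂ x.2 y.2) :=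
          add_le_add hA' hB'
    _ = (ρ₁ x.1 y.1 + ρ₂ x.2 y.2) - (α * κ₁ * ρ₁ x.1 y.1 + (1 - α) * κ₂ * ρ₂ x.2 y.2) := by ring
    _ ≤ (1 - min (α * κ₁) ((1 - α) * κ₂)) * sumDist ρ₁ ρ₂ x y := by
          unfold sumDist; nlinarith [hmin₁, hmin₂]

end Tensorization

end Literature.Probability.MarkovChains
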